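import Mathlib.Analysis.InnerProductSpace.GramSchmidtOrtho
import Mathlib.Analysis.InnerProductSpace.Continuous
import HarnessLib

/-!
# Continuity of the Gram–Schmidt process in the input family (any `RCLike` scalar field)

For continuous vector fields `u i : X → E` (`i` in a well-ordered index type) with values in an
inner product space over `𝕜 = ℝ` or `ℂ`, which are linearly independent at the points of a set
`s ⊆ X`, the Gram–Schmidt vectors `x ↦ gramSchmidt 𝕜 (u · x) i` and their normalisations
`x ↦ gramSchmidtNormed 𝕜 (u · x) i` are continuous on `s` (`continuousOn_gramSchmidt_family`,
`continuousOn_gramSchmidtNormed_family`): well-founded induction along Mathlib's recursion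
`gramSchmidt_def''`, the denominators `‖gⱼ‖²` being non-zero on independent families. This is the
`RCLike` / `ContinuousOn` form of the tree's real, everywhere-independent statements
`Literature.Topology.FourManifolds.continuous_gramSchmidt_family` and
`Literature.Topology.FourManifolds.continuousOn_gramSchmidt` (needed over `ℂ` for continuous local
UNITARY frames of complex tangent planes, `Literature/Geometry/Kaehler/HolomorphicChain*`).
All [folklore].
-/

noncomputable section

open InnerProductSpace Finset
open scoped InnerProductSpace

namespace Literature.Analysis.InnerProduct

variable (𝕜 : Type*) [RCLike 𝕜] {E : Type*} [NormedAddCommGroup E] [InnerProductSpace 𝕜 E]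
  {ι : Type*} [LinearOrder ι] [LocallyFiniteOrderBot ι] [WellFoundedLT ι]
  {X : Type*} [TopologicalSpace X]

/-- **Gram–Schmidt is continuous in the family, on the set where the family is independent.**
If `u i : X → E` are continuous on `s` and `(u i x)ᵢ` is linearly independent for `x ∈ s`, then
`x ↦ gramSchmidt 𝕜 (u · x) i` is continuous on `s`. [folklore] -/
theorem continuousOn_gramSchmidt_family {u : ι → X → E} {s : Set X}
    (hu : ∀ i, ContinuousOn (u i) s) (hli : ∀ x ∈ s, LinearIndependent 𝕜 (u · x)) (i : ι) :
    ContinuousOn (fun x => gramSchmidt 𝕜 (u · x) i) s := by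
  induction i using WellFoundedLT.induction with | ind i ih =>
  set c : ι → X → 𝕜 := fun j x =>
    ⟪gramSchmidt 𝕜 (u · x) j, u i x⟫_𝕜 / ((‖gramSchmidt 𝕜 (u · x) j‖ ^ 2 : ℝ) : 𝕜) with hc
  have heq : ∀ x, gramSchmidt 𝕜 (u · x) i =
      u i x - ∑ j ∈ Finset.Iio i, c j x • gramSchmidt 𝕜 (u · x) j := by
    intro x
    rw [eq_sub_of_add_eq (gramSchmidt_def'' 𝕜 (u · x) i).symm]
    simp only [hc, RCLike.ofReal_pow]
  refine ContinuousOn.congr (f := fun x => u i x - ∑ j ∈ Finset.Iio i, c j x • gramSchmidt 𝕜 (u · x) j)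
    ?_ (fun x _ => heq x)
  refine (hu i).sub (continuousOn_finsetSum _ fun j hj => ?_)
  have hj' : j < i := Finset.mem_Iio.1 hj
  refine ContinuousOn.smul ?_ (ih j hj')
  refine ContinuousOn.div ((ih j hj').inner (hu i)) ?_ fun x hx => ?_
  · exact RCLike.continuous_ofReal.comp_continuousOn (((ih j hj').norm).pow 2)
  · exact_mod_cast pow_ne_zero 2 (norm_ne_zero_iff.2 (gramSchmidt_ne_zero j (hli x hx)))

/-- The normalised Gram–Schmidt vectors `x ↦ gramSchmidtNormed 𝕜 (u · x) i` of fields continuous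
on `s` and independent at the points of `s` are continuous on `s`. [folklore] -/
theorem continuousOn_gramSchmidtNormed_family {u : ι → X → E} {s : Set X}
    (hu : ∀ i, ContinuousOn (u i) s) (hli : ∀ x ∈ s, LinearIndependent 𝕜 (u · x)) (i : ι) :
    ContinuousOn (fun x => gramSchmidtNormed 𝕜 (u · x) i) s := by
  unfold gramSchmidtNormed
  have h := continuousOn_gramSchmidt_family 𝕜 hu hli i
  have h' : ContinuousOn (fun x => ((‖gramSchmidt 𝕜 (u · x) i‖ : ℝ) : 𝕜)⁻¹) s := by
    refine (RCLike.continuous_ofReal.comp_continuousOn h.norm).inv₀ fun x hx => ?_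
    change ((‖gramSchmidt 𝕜 (u · x) i‖ : ℝ) : 𝕜) ≠ 0
    exact_mod_cast norm_ne_zero_iff.2 (gramSchmidt_ne_zero i (hli x hx))
  exact ContinuousOn.smul h' h

/-- Everywhere version: continuous, pointwise independent fields have continuous Gram–Schmidt
orthonormalisation. [folklore] -/
theorem continuous_gramSchmidtNormed_family {u : ι → X → E} (hu : ∀ i, Continuous (u i))
    (hli : ∀ x, LinearIndependent 𝕜 (u · x)) (i : ι) :
    Continuous fun x => gramSchmidtNormed 𝕜 (u · x) i := by
  rw [← continuousOn_univ]
  exact continuousOn_gramSchmidtNormed_family 𝕜 (fun i => (hu i).continuousOn)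
    (fun x _ => hli x) i

end Literature.Analysis.InnerProduct
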